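import Mathlib.AlgebraicGeometry.Sites.Representability
import Mathlib.AlgebraicGeometry.ResidueField
import Mathlib.CategoryTheory.Subfunctor.Basic
import HarnessLib

/-!
# Open conditions define open subfunctors; an open cover by representable subfunctors represents

Topic: `Literature/AlgebraicGeometry/Motives` (next to the Grassmannian functor files it serves).
The classical representability criterion (EGA I (1971) 0.4.5.4; Görtz–Wedhorn, *Algebraic
Geometry I*, Def. 8.8 and Thm. 8.9; Stacks 01JJ) in the form consumers state it, on top of
Mathlib's `AlgebraicGeometry.Scheme.LocalRepresentability.isRepresentable` (which asks for
relatively representable open immersions `yoneda.obj (X i) ⟶ F` that are jointly locally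
surjective):

* `isOpenImmersion_presheaf_of_openCondition` — if `f : h_X ⟶ F` is injective on `T`-points and
  its image is cut out by an OPEN CONDITION (for every `x ∈ F(T)` an open `U_x ⊆ T` with
  `h^*x ∈ im f ↔ h(T′) ⊆ U_x` for all `h : T′ → T`), then `f` is a relatively representable open
  immersion (`IsOpenImmersion.presheaf f`): the fibre product `h_X ×_F h_T` is the open subscheme
  `U_x`.
* `isLocallySurjective_sigmaDesc_of_openCondition` — if moreover a family `f i` hits every
  field-valued point of `F`, then the opens `U i s` cover every `T` (test at `Spec κ(t) → T`) and
  `∐ h_{X i} ⟶ F` is locally surjective for the Zariski topology.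
* `isRepresentable_of_openCondition_cover` — hence a Zariski sheaf with such a family is
  representable (by the scheme glued from the `X i`).
* `isRepresentable_of_openSubfunctor_cover` — the same phrased with representable SUBFUNCTORS
  `P i ⊆ F` cut out by open conditions (the printed form of Görtz–Wedhorn Thm. 8.9).

Typical use: the standard affine charts of a Grassmannian / projective space / `Quot` functor,
where the open condition is "a fixed finite family generates the fibre", an open condition by
`Literature.RingTheory.FittingIdeal.LinearMap.surjective_baseChange_iff_range_comap_subset`.

## Sources

* A. Grothendieck, J. Dieudonné, *Éléments de géométrie algébrique I* (Springer 1971), Ch. 0,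
  4.5.4.
* U. Görtz, T. Wedhorn, *Algebraic Geometry I* (2nd ed. 2020), Def. 8.8, Thm. 8.9.
* The Stacks Project, Tag 01JJ.

Not here: the comparison "Zariski sheaf on affine schemes ⇒ Zariski sheaf on `Sch`" (the
promotion of a functor on rings to a functor on schemes), and separatedness of the glued scheme.
-/

namespace Literature.AlgebraicGeometry.Motives

universe u

open CategoryTheory CategoryTheory.Limits Opposite _root_.AlgebraicGeometry
  _root_.AlgebraicGeometry.Scheme

section OpenCondition

variable {F : Scheme.{u}ᵒᵖ ⥤ Type u} {X : Scheme.{u}} (f : yoneda.obj X ⟶ F)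

/-- **An injective morphism of presheaves on `Sch` whose image is cut out by an open condition is a
relatively representable open immersion** (EGA I (1971) 0.4.5.4; Görtz–Wedhorn Def. 8.8 /
Thm. 8.9; Stacks 01JJ): if `f : h_X → F` is injective on `T`-points and for every `x ∈ F(T)`
there is an open `U_x ⊆ T` such that, for all `h : T′ → T`, `h^* x` lies in the image of `f` iff
`h(T′) ⊆ U_x`, then for every `x ∈ F(T)` the fibre product `h_X ×_F h_T` is represented by the open
subscheme `U_x`, i.e. `f` is `IsOpenImmersion.presheaf`. [cite: GortzWedhorn2020, Thm. 8.9 (p. 212)] -/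
theorem isOpenImmersion_presheaf_of_openCondition
    (hinj : ∀ T : Scheme.{u}, Function.Injective (f.app (op T)))
    (U : ∀ {T : Scheme.{u}}, F.obj (op T) → T.Opens)
    (hU : ∀ {T T' : Scheme.{u}} (x : F.obj (op T)) (h : T' ⟶ T),
      F.map h.op x ∈ Set.range (f.app (op T')) ↔ Set.range h ⊆ (U x : Set T)) :
    IsOpenImmersion.presheaf f := by
  refine MorphismProperty.relative.of_exists ?_
  intro T g
  -- the Yoneda element of `g` and its open set
  set x : F.obj (op T) := yonedaEquiv g with hx
  let V : T.Opens := U x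
  -- the restriction of `x` to `V` lies in the image of `f`: a `V`-point of `X`
  have hV : F.map V.ι.op x ∈ Set.range (f.app (op (V : Scheme.{u}))) :=
    (hU x V.ι).mpr (by rw [Scheme.Opens.range_ι])
  obtain ⟨φ, hφ⟩ := hV
  refine ⟨(V : Scheme.{u}), yoneda.map φ, V.ι, ?_, inferInstance⟩
  -- the square is a pullback, checked objectwise in `Type u`
  have hg : ∀ {T' : Scheme.{u}} (h : T' ⟶ T), g.app (op T') h = F.map h.op x := by
    intro T' h
    rw [hx, yonedaEquiv_naturality, yonedaEquiv_apply]
    simp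
  have key : ∀ {T' : Scheme.{u}} (h' : T' ⟶ V), f.app (op T') (h' ≫ φ) = F.map (h' ≫ V.ι).op x := by
    intro T' h'
    have hnat := NatTrans.naturality_apply f h'.op φ
    simp only [yoneda_obj_map, Quiver.Hom.unop_op, TypeCat.ofHom_apply] at hnat
    rw [hnat, hφ, op_comp, F.map_comp]
    rfl
  refine IsPullback.of_forall_isPullback_app fun ⟨T'⟩ => ?_
  rw [Types.isPullback_iff]
  refine ⟨?_, ?_, ?_⟩
  · ext h'
    change f.app (op T') (h' ≫ φ) = g.app (op T') (h' ≫ V.ι)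
    rw [hg, key]
  · intro h₁ h₂ ⟨_, h12⟩
    exact (cancel_mono V.ι).mp h12
  · intro a (h : T' ⟶ T) hah
    change f.app (op T') a = g.app (op T') h at hah
    rw [hg] at hah
    have hrange := (hU x h).mp ⟨a, hah⟩
    have hrange' : Set.range h ⊆ Set.range V.ι := by rwa [Scheme.Opens.range_ι]
    refine ⟨IsOpenImmersion.lift V.ι h hrange', ?_, IsOpenImmersion.lift_fac _ _ _⟩
    apply hinj
    change f.app (op T') (IsOpenImmersion.lift V.ι h hrange' ≫ φ) = f.app (op T') a
    rw [hah, key, IsOpenImmersion.lift_fac]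

end OpenCondition

section Cover

variable {F : Scheme.{u}ᵒᵖ ⥤ Type u} {ι : Type u} {X : ι → Scheme.{u}}
  (f : ∀ i, yoneda.obj (X i) ⟶ F)

/-- **A family of open subfunctors covering the field-valued points covers** (Görtz–Wedhorn
Thm. 8.9, proof; Stacks 01JJ): if each `f i : h_{X i} → F` has image cut out by an open condition
`U i`, and every `x ∈ F(Spec K)`, `K` a field, lies in the image of some `f i`, then for every
`s ∈ F(T)` the opens `U i s` cover `T` (test at `Spec κ(t) → T`), so `∐ h_{X i} → F` is locally
surjective for the Zariski topology. [cite: GortzWedhorn2020, Thm. 8.9 (p. 212)] -/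
theorem isLocallySurjective_sigmaDesc_of_openCondition
    (U : ∀ (i : ι) {T : Scheme.{u}}, F.obj (op T) → T.Opens)
    (hU : ∀ (i : ι) {T T' : Scheme.{u}} (x : F.obj (op T)) (h : T' ⟶ T),
      F.map h.op x ∈ Set.range ((f i).app (op T')) ↔ Set.range h ⊆ (U i x : Set T))
    (hcover : ∀ (K : Type u) [Field K] (x : F.obj (op (Spec (CommRingCat.of K)))),
      ∃ i, x ∈ Set.range ((f i).app (op (Spec (CommRingCat.of K))))) :
    Presheaf.IsLocallySurjective Scheme.zariskiTopology (Sigma.desc f) := by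
  constructor
  intro T s
  -- the opens `U i s` cover `T`: test on residue fields
  have hcov : ∀ t : T, ∃ i, t ∈ U i s := by
    intro t
    obtain ⟨i, hi⟩ := hcover (T.residueField t) (F.map (T.fromSpecResidueField t).op s)
    refine ⟨i, ?_⟩
    have hsub := (hU i s (T.fromSpecResidueField t)).mp hi
    rw [Scheme.range_fromSpecResidueField, Set.singleton_subset_iff] at hsub
    exact hsub
  let 𝒰 : T.OpenCover := Cover.mkOfCovers ι (fun i => ((U i s : T.Opens) : Scheme.{u}))
    (fun i => (U i s).ι) (fun t => by
      obtain ⟨i, hi⟩ := hcov t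
      obtain ⟨y, hy⟩ := (Scheme.Opens.range_ι (U i s)).symm.subset hi
      exact ⟨i, y, hy⟩)
  refine Scheme.zariskiTopology.superset_covering ?_ 𝒰.mem_grothendieckTopology
  rintro T' h ⟨Y, a, b, ⟨i⟩, rfl⟩
  change ι at i
  change T' ⟶ ((U i s : T.Opens) : Scheme.{u}) at a
  -- on `U i s` the section comes from `X i`
  obtain ⟨φ, hφ⟩ := (hU i s (U i s).ι).mpr (by rw [Scheme.Opens.range_ι])
  refine ⟨(Sigma.ι (fun i => yoneda.obj (X i)) i).app (op T') (a ≫ φ), ?_⟩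
  rw [← NatTrans.comp_app_apply, Sigma.ι_desc]
  have hnat := NatTrans.naturality_apply (f i) a.op φ
  simp only [yoneda_obj_map, Quiver.Hom.unop_op, TypeCat.ofHom_apply] at hnat
  change (f i).app (op T') (a ≫ φ) = F.map (a ≫ (U i s).ι).op s
  rw [hnat, hφ, op_comp, F.map_comp]
  rfl

end Cover

section Representable

/-- **Representability from an open cover by representable subfunctors** (EGA I (1971) 0.4.5.4;
Görtz–Wedhorn Thm. 8.9; Stacks 01JJ), classical form on top of Mathlib's
`Scheme.LocalRepresentability.isRepresentable`: a Zariski sheaf `F` on `Sch` is representable as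
soon as it receives injective maps `f i : h_{X i} → F` whose images are cut out by open conditions
`U i` and which jointly hit every field-valued point of `F`. The representing scheme is glued from
the `X i` along the `U i`. [cite: GortzWedhorn2020, Thm. 8.9 (p. 212)] -/
theorem isRepresentable_of_openCondition_cover (F : Sheaf Scheme.zariskiTopology.{u} (Type u))
    {ι : Type u} {X : ι → Scheme.{u}} (f : ∀ i, yoneda.obj (X i) ⟶ F.1)
    (hinj : ∀ (i : ι) (T : Scheme.{u}), Function.Injective ((f i).app (op T)))
    (U : ∀ (i : ι) {T : Scheme.{u}}, F.1.obj (op T) → T.Opens)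
    (hU : ∀ (i : ι) {T T' : Scheme.{u}} (x : F.1.obj (op T)) (h : T' ⟶ T),
      F.1.map h.op x ∈ Set.range ((f i).app (op T')) ↔ Set.range h ⊆ (U i x : Set T))
    (hcover : ∀ (K : Type u) [Field K] (x : F.1.obj (op (Spec (CommRingCat.of K)))),
      ∃ i, x ∈ Set.range ((f i).app (op (Spec (CommRingCat.of K))))) :
    F.1.IsRepresentable := by
  haveI := isLocallySurjective_sigmaDesc_of_openCondition f U hU hcover
  exact Scheme.LocalRepresentability.isRepresentable
    (fun i => isOpenImmersion_presheaf_of_openCondition (f i) (hinj i) (U i) (hU i))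

end Representable

section Subfunctors

/-- **Representability from an open cover by representable SUBFUNCTORS** (Görtz–Wedhorn Thm. 8.9 in its
printed form): a Zariski sheaf `F` on `Sch` covered by subfunctors `P i ⊆ F` that are cut out by open
conditions `U i`, each representable (`(P i).toFunctor.IsRepresentable`), and which jointly contain every
field-valued point, is representable.  (Reduction to `isRepresentable_of_openCondition_cover` with
`f i := (reprW (P i)).hom ≫ (P i).ι`: injective, with image `P i`.)
[cite: GortzWedhorn2020, Thm. 8.9 (p. 212)] -/
theorem isRepresentable_of_openSubfunctor_cover (F : Sheaf Scheme.zariskiTopology.{u} (Type u))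
    {ι : Type u} (P : ι → Subfunctor F.1) (hrep : ∀ i, (P i).toFunctor.IsRepresentable)
    (U : ∀ (i : ι) {T : Scheme.{u}}, F.1.obj (op T) → T.Opens)
    (hU : ∀ (i : ι) {T T' : Scheme.{u}} (x : F.1.obj (op T)) (h : T' ⟶ T),
      F.1.map h.op x ∈ (P i).obj (op T') ↔ Set.range h ⊆ (U i x : Set T))
    (hcover : ∀ (K : Type u) [Field K] (x : F.1.obj (op (Spec (CommRingCat.of K)))),
      ∃ i, x ∈ (P i).obj (op (Spec (CommRingCat.of K)))) :
    F.1.IsRepresentable := by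
  -- the representing charts and the induced injective maps into `F`
  let f : ∀ i, yoneda.obj (P i).toFunctor.reprX ⟶ F.1 := fun i => (P i).toFunctor.reprW.hom ≫ (P i).ι
  have hrange : ∀ (i : ι) (T : Scheme.{u}),
      Set.range ((f i).app (op T)) = (P i).obj (op T) := by
    intro i T
    ext y
    constructor
    · rintro ⟨g, rfl⟩
      exact ((P i).toFunctor.reprW.hom.app (op T) g).2
    · intro hy
      refine ⟨(P i).toFunctor.reprW.inv.app (op T) ⟨y, hy⟩, ?_⟩
      change (P i).ι.app (op T) (((P i).toFunctor.reprW.inv ≫ (P i).toFunctor.reprW.hom).app (op T)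
        ⟨y, hy⟩) = y
      rw [Iso.inv_hom_id]
      rfl
  refine isRepresentable_of_openCondition_cover F f (fun i T => ?_) U (fun i T T' x h => ?_) ?_
  · exact Subtype.val_injective.comp ((P i).toFunctor.reprW.app (op T)).toEquiv.injective
  · rw [hrange, ← hU i x h]
  · intro K _ x
    obtain ⟨i, hi⟩ := hcover K x
    exact ⟨i, by rw [hrange]; exact hi⟩

end Subfunctors

end Literature.AlgebraicGeometry.Motives
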